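/-
Copyright: statement-level skeleton of a published paper (lit-balaban cell, Phase-2 proof seat p39 gen 32). No proof claims
beyond what the kernel checks below.
-/
import Literature.MathematicalPhysics.QuantumFieldTheory.Balaban1983to89.B3Eq124IndexFourZero

/-!
# Bałaban, *(Higgs)₂,₃ quantum fields in a finite volume. III*, CMP 88 (1983) [Balaban1983Higgs3], p. 417: THE INDEX `(6,0)` OF
# THE VACUUM-ENERGY COUNTERTERM (1.24) — `∂⁶/∂e⁶ log∫dA∫dφ e^{−S^ε(A,φ)}∣_{e=λ=0}` with print's mass counterterm inserted, IN
# CUMULANT FORM with the vector field integrated out: `⟨P₆⟩₀ − 15⟨P₂⟩₀⟨P₄⟩₀ + 30⟨P₂⟩₀³`; Wick's theorem for six fields and the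
# sixth moments (fifteen pairings) of the free vector field

statement-level skeleton of published theorems with citation tags; proofs where landed; nothing here is a claim about the
Yang–Mills mass gap.

[cite: Balaban1983Higgs3, (1.24) p.417 (PDF 7) and the first paragraph of p.418 (PDF 8); (1.19)–(1.22) p.416 (PDF 6); (1.23) p.417;
(1.8), (1.10) p.413 (PDF 3); (2.26) p.431 (PDF 21)] [cite: GlimmJaffeQP1987, §8.5, (9.1.3)].  Unit `lit-balaban-p39-g32` (Phase-2
proof seat p39, gen 32), free-target protocol G.5-34(d), ZERO head weight: OPTIONAL LOCATED MEMBER of row **B3.Eq1.24** (and of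
B3.Eq1.19-1.22 for the vector-field moments of §1) of `HOME/lit-balaban-r15/ROWS-B3.md` (owner r15; heads `proved`, decls of record
not restated); TAKING `HOME/STATUS.md` 2026-08-24 (BRICK 22 of this seat's series) = the `(6,0)` half of the successor option (F) of
`HOME/lit-balaban-p39/DESIGN-weight6-next.md` (the row owner's preference, r15 g20 2026-08-24T18:22:10Z: the open indices `(4,0)`,
`(4,1)`, `(6,0)` *"in structural/cumulant form"*; BRICK 21 `B3Eq124IndexFourZero` did `(4,0)` and the raw cumulant of `(6,0)`).
IMPORTED BY NAME, nothing of record redeclared: BRICK 21 (this seat, gen 32: `cv`, `WAI` and its closure lemmas, the fourth-moment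
shapes `wai_sum_pow_four` … `wai_sum_pow_four'`, `kap`, `fM_zero`, `P2`, `P4`, `wai_DkM_two`, `wai_DkM_four`, `integral_DkM_J_zero_eq`,
`eval_Dpoly_six`, `iteratedDeriv_logZ_massCurve_raw` (the raw `(6,0)`: `Z₆/Z₀ − 15Z₂Z₄/Z₀² + 30(Z₂/Z₀)³`), `cts_odd_zero`, `polyCts` and
its lemmas), through it BRICK 20 `B3ChargeInsertionsHigher` (`DkM`, `fM`, §8), BRICK 13 (`integral_J_zero_eq`), BRICK 7 (`J`, `WA`,
`toVec`, `ZA_pos`), and this seat's Gaussian toolbox `B3WTCovariance.gaussIBP`, `B3WTPropagator.Kbil_gcol` / `gcol` /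
`hasDerivAt_inner_transl`, `B3WT226Traces.Z_pos`, the typer's `B3WickVertexCalculus.ExpGrowth` (`common`, `integrable`).

PDF held: `paper:balaban1983-higgs-2-3-quantum-fields-finite-volume` (journal page = PDF page + 410); pp. 413, 416–418, 431 read for
BRICKS 1/7/12–21 on the ×2 renders `run/shared/lean/pub/pub-balaban/b2b-balaban-ref1/pages/1983-cmp88-higgs23-III/…-p003-x2.png`,
`…-p006-x2.png`, `…-p007-x2.png` (re-read as an image 2026-08-24T21:12Z for BRICK 21), `…-p008-x2.png`, `…-p021-x2.png`; no new
quotation is introduced here (the sentences served are (1.24) p. 417 and p. 418 *"Terms of this expansion are described by connected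
graphs without external legs (vacuum graphs). To renormalize the theory it is sufficient to take the terms in the expansion (1.24)
restricted by the condition 2 ≤ α + 2β ≤ 6"*, quoted in BRICKS 13/17/21 — `(6,0)` is the top of that range).

THE MATHEMATICS (ours; frame = Glimm–Jaffe §8.5 / (9.1.3)).  (§1) **Wick's theorem for six fields**, recursion step
(`moment6_step`): `∫dφ e^{−½⟨φ,Kφ⟩}ℓ₁⋯ℓ₆ = Σ_{m=2}^{6} c_{1m}·∫dφ e^{−½⟨φ,Kφ⟩}Π_{n≠1,m}ℓ_n` for linear functionals `ℓ_a = ⟪φ(x_a),v_a⟫`,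
`c_{ab} = C^η_{M²}(x_a,x_b)⟪v_a,v_b⟫` — one Gaussian integration by parts (`gaussIBP` in the direction `C(·,x₁)⊗v₁`, `g = ℓ₂⋯ℓ₆`; the
growth bounds come from the `ExpGrowth` toolbox, `ExpGrowth.common`), for the scalar Gaussian of this seat's calculus at any `N`, `M²`;
applied at `N := d` to the free vector field of (1.20) (legs `⟪A(b₋),e_{μ_b}⟫ = A_b`) and closed by BRICK 21's fourth moments it gives
**`integral_WA_toVec_six`: `⟨A_{b₁}⋯A_{b₆}⟩ = Z_A·pair15(b₁,…,b₆)`**, `pair15 = Σ_{m=2}^{6}cv(b₁,b_m)·pair3(rest)` the FIFTEEN PAIRINGS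
(`pair3` = the three pairings of BRICK 21; both defs with bodies).  (§2) The moments of the ELEVEN sixth-degree shapes of `D^M_6(0)`
in the bond sums `S_i = Σ_bκ_i(φ;b)A_bⁱ` (`κ_i = η^dc²ηⁱ⟪φ(b₋),qⁱφ(b₊)⟫`, BRICK 21 `kap`): `S₆`, `S₁S₅`, `S₂S₄`, `S₃²`, `S₁²S₄`,
`S₁S₂S₃`, `S₂³`, `S₁³S₃`, `S₁²S₂²`, `S₁⁴S₂`, `S₁⁶` (`wai_sum_pow_six` … `wai_s1_pow_six`: each `= Z_A·` a bond sum of `κ`'s times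
`pair15` at the corresponding repeated arguments; the products of up to six bond sums are expanded by the private `sum_mul₃…₆`).
(§3) `D^M_6 = B₆(f₁,…,f₆) = f₆ + 6f₁f₅ + 15f₂f₄ + 10f₃² + 15f₁²f₄ + 60f₁f₂f₃ + 15f₂³ + 20f₁³f₃ + 45f₁²f₂² + 15f₁⁴f₂ + f₁⁶` (`DkM_six` ←
BRICK 21 `eval_Dpoly_six`), `f_i(0) = S_i − ½ct⁽ⁱ⁾(0)Q` with `ct′ = ct‴ = ct⁽⁵⁾ = 0` at `0` (even curve); expanding the counterterm
factors gives 11 sixth-degree shapes + 7 fourth/second-degree shapes against bubbles (BRICK 21's) + a pure bubble polynomial, whence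
the EXPLICIT `P6` (def with body) and **`wai_DkM_six`: `∫dA W_A·D^M_6(0;A,φ) = Z_A·P₆(φ)`** at every `φ`.  (§4) With BRICK 21's raw
cumulant and Fubini, `Z_k = Z_A∫W₀P_k` (`k = 2, 4, 6`), `Z₀ = Z_AZ₀^{sc}`: THE HEADLINE **`iteratedDeriv_six_logZ_massCurve`:
`∂⁶/∂e⁶∣₀ log Z^{ct} = ⟨P₆⟩₀ − 15⟨P₂⟩₀⟨P₄⟩₀ + 30⟨P₂⟩₀³`** (hypotheses = BRICK 20 §8's + `ct` even + `ct(0) = 0`), and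
**`iteratedDeriv_six_logZ_poly`** for print's curve `δm²_{(2,0)}e² + δm²_{(4,0)}e⁴` with no hypothesis beyond `η^d, m², μ₀² > 0`
(`ct″(0) = 2δm²_{(2,0)}`, `ct⁗(0) = 24δm²_{(4,0)}`, `ct⁽⁶⁾(0) = 0`).

WHICH COEFFICIENT OF (1.24) THIS IS, AND WHAT IS LEFT SYMBOLIC (as for BRICK 21, r15's ask 2026-08-24T21:00:40Z).  ORDER OF
DIFFERENTIATION: pure `e`, SIX times, two-sided, at `e = 0`, `λ = 0` throughout (no `λ`-derivative; the order question of BRICKS 16–18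
does not arise), ALONG THE MASS CURVE `m² + δm²(e,0)` inside the measure; the `(α,β) = (6,0)` term of r01's/r15's `E1of124R` sum is
`(e⁶/6!)` times this derivative.  WHICH LETTERS OF (1.23) ENTER: at `λ = 0`, `ct(e) = δm²_{(2,0)}e² + δm²_{(4,0)}e⁴` (`δm²_{(3,0)} = 0`
— hypothesis-free here since `polyCts` is even; see BRICK 21's header for print's displayed expansion); the insertions see `ct″(0) =
2δm²_{(2,0)}` (in `P₂`, `P₄`, `P₆`), `ct⁗(0) = 24δm²_{(4,0)}` (in `P₄` linearly; in `P₆` through `15f₂f₄`, `15f₁²f₄` and the bubble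
products) and `ct⁽⁶⁾(0)` (`= 0` for print's quartic curve; kept as the letter `ct6` of `P6`, entering linearly as `−½ct6·Q`).  WHAT IS
LEFT SYMBOLIC: the three free scalar Gaussian expectations `⟨P₆⟩₀`, `⟨P₄⟩₀`, `⟨P₂⟩₀` (`⟨F⟩₀ = ∫W₀F/∫W₀`, `W₀ = e^{−½⟨φ,(−Δ^η_0+m²)φ⟩}`)
of explicit polynomials of degree ≤ 12, 8, 4 in `φ`; the vector-field integrals are DONE (the `cv`/`pair3`/`pair15` coefficients).

WHAT THIS FILE PROVES — definitions WITH BODIES: `pair3`, `pair15` (the pairings), `P6`; theorems as above; no named fact, no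
`sorry`, standard axioms.

HONEST SCOPE.  (a) Cumulant form as the row owner allows: no scalar Wick theorem, no graph drawn, no estimate as `ε → 0`,
nothing about p. 418's *"the other terms are convergent"*.  (b) With BRICK 21 the indices `(α,0)`, `α ≤ 6`, of p. 418's range are
all in the tree in this form; `(4,1)` (one `λ`-derivative within `[0,∞)` at `0⁺` on top of `∂⁴_e`) is the companion BRICK 23
`B3Eq124IndexFourOne` of this seat.  (c) Finite torus, Feynman gauge, any `d`, `N`, mesh, level; `λ = 0`; scalar `δm²` as
printed.  (d) `moment6_step` is stated as the one-step recursion (five four-field integrals), not as the closed fifteen-term sum;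
the closed form is given for the vector field only (`integral_WA_toVec_six`).

References: [Balaban1983Higgs3] T. Bałaban, *(Higgs)₂,₃ quantum fields in a finite volume. III. Renormalization*, CMP 88 (1983)
411–445, pp. 413, 416–418, 431; [Balaban1982Higgs1] T. Bałaban, CMP 85 (1982) 603–636, (1.7), (1.11) p. 605; [GlimmJaffeQP1987]
J. Glimm, A. Jaffe, *Quantum Physics. A Functional Integral Point of View*, 2nd ed. (Springer 1987), §8.5, §9.1 (9.1.3).
Unit `lit-balaban-p39` gen 32 (literature-prover-lit-balaban-p39-g32-0), HOME `run/shared/lean/pub/lit-balaban/`, 2026-08-24.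
-/

noncomputable section

open scoped BigOperators InnerProductSpace Topology

namespace Literature.MathematicalPhysics.QuantumFieldTheory.Balaban1983to89.B3Eq124IndexSixZero

open _root_.MeasureTheory _root_.Filter _root_.Set
open LatticeFieldCalculus B3WT223Instance B3WTPropagator B3WTCovariance B3WickVertexCalculus B3Eq122ChargeWick
  B3ChargeInsertionsHigher B3ChargeInsertionsHigher.MassCurve B3Eq124IndexFourZero MvPolynomial

variable {P : Params} {j N : ℕ} (C : HiggsLattice.ChargeData N) (η w c m2 μ2 : ℝ)

/-! ## §1 Wick's theorem for SIX fields (one Gaussian integration by parts on top of `B3WTWick.moment4`) and the SIXTH MOMENTS of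
the free vector field: fifteen pairings -/

/-- **Sixth moments of `dμ_{C^η_{M²}}`, recursion step (Wick)**: for `ℓ_a(φ) = ⟪φ(x_a),v_a⟫` and `c_{ab} = C^η_{M²}(x_a,x_b)⟪v_a,v_b⟫`,
`∫dφ e^{−½⟨φ,Kφ⟩}ℓ₁ℓ₂ℓ₃ℓ₄ℓ₅ℓ₆ = Σ_{m=2}^{6} c_{1m}·∫dφ e^{−½⟨φ,Kφ⟩}Π_{n≠1,m}ℓ_n` — Gaussian integration by parts (this seat's
`B3WTCovariance.gaussIBP`) in the direction `C(·,x₁)⊗v₁` applied to `g = ℓ₂ℓ₃ℓ₄ℓ₅ℓ₆`. [cite: Balaban1983Higgs3, (2.26) p.431]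
[cite: GlimmJaffeQP1987, (9.1.3)] -/
theorem moment6_step (M2 : ℝ) (hw : 0 < w) (hM : 0 < M2) (x₁ x₂ x₃ x₄ x₅ x₆ : Site P j)
    (v₁ v₂ v₃ v₄ v₅ v₆ : EuclideanSpace ℝ (Fin N)) :
    ∫ φ, weight C η w c M2 (0 : VecField P j ℝ) φ *
        (⟪φ x₁, v₁⟫_ℝ * (⟪φ x₂, v₂⟫_ℝ * (⟪φ x₃, v₃⟫_ℝ * (⟪φ x₄, v₄⟫_ℝ * (⟪φ x₅, v₅⟫_ℝ * ⟪φ x₆, v₆⟫_ℝ))))) =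
      G w c M2 x₁ x₂ * ⟪v₁, v₂⟫_ℝ *
          (∫ φ, weight C η w c M2 (0 : VecField P j ℝ) φ * (⟪φ x₃, v₃⟫_ℝ * (⟪φ x₄, v₄⟫_ℝ * (⟪φ x₅, v₅⟫_ℝ * ⟪φ x₆, v₆⟫_ℝ))))
        + G w c M2 x₁ x₃ * ⟪v₁, v₃⟫_ℝ *
          (∫ φ, weight C η w c M2 (0 : VecField P j ℝ) φ * (⟪φ x₂, v₂⟫_ℝ * (⟪φ x₄, v₄⟫_ℝ * (⟪φ x₅, v₅⟫_ℝ * ⟪φ x₆, v₆⟫_ℝ))))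
        + G w c M2 x₁ x₄ * ⟪v₁, v₄⟫_ℝ *
          (∫ φ, weight C η w c M2 (0 : VecField P j ℝ) φ * (⟪φ x₂, v₂⟫_ℝ * (⟪φ x₃, v₃⟫_ℝ * (⟪φ x₅, v₅⟫_ℝ * ⟪φ x₆, v₆⟫_ℝ))))
        + G w c M2 x₁ x₅ * ⟪v₁, v₅⟫_ℝ *
          (∫ φ, weight C η w c M2 (0 : VecField P j ℝ) φ * (⟪φ x₂, v₂⟫_ℝ * (⟪φ x₃, v₃⟫_ℝ * (⟪φ x₄, v₄⟫_ℝ * ⟪φ x₆, v₆⟫_ℝ))))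
        + G w c M2 x₁ x₆ * ⟪v₁, v₆⟫_ℝ *
          (∫ φ, weight C η w c M2 (0 : VecField P j ℝ) φ * (⟪φ x₂, v₂⟫_ℝ * (⟪φ x₃, v₃⟫_ℝ * (⟪φ x₄, v₄⟫_ℝ * ⟪φ x₅, v₅⟫_ℝ)))) := by
  set h : Cfg P j N := gcol w c M2 x₁ v₁ with hh
  set l₂ : ℝ := ⟪h x₂, v₂⟫_ℝ with hl₂
  set l₃ : ℝ := ⟪h x₃, v₃⟫_ℝ with hl₃
  set l₄ : ℝ := ⟪h x₄, v₄⟫_ℝ with hl₄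
  set l₅ : ℝ := ⟪h x₅, v₅⟫_ℝ with hl₅
  set l₆ : ℝ := ⟪h x₆, v₆⟫_ℝ with hl₆
  set g : Cfg P j N → ℝ := fun φ =>
    ⟪φ x₂, v₂⟫_ℝ * (⟪φ x₃, v₃⟫_ℝ * (⟪φ x₄, v₄⟫_ℝ * (⟪φ x₅, v₅⟫_ℝ * ⟪φ x₆, v₆⟫_ℝ))) with hg
  set g' : Cfg P j N → ℝ := fun φ =>
    l₂ * (⟪φ x₃, v₃⟫_ℝ * (⟪φ x₄, v₄⟫_ℝ * (⟪φ x₅, v₅⟫_ℝ * ⟪φ x₆, v₆⟫_ℝ)))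
      + ⟪φ x₂, v₂⟫_ℝ * (l₃ * (⟪φ x₄, v₄⟫_ℝ * (⟪φ x₅, v₅⟫_ℝ * ⟪φ x₆, v₆⟫_ℝ))
        + ⟪φ x₃, v₃⟫_ℝ * (l₄ * (⟪φ x₅, v₅⟫_ℝ * ⟪φ x₆, v₆⟫_ℝ)
          + ⟪φ x₄, v₄⟫_ℝ * (l₅ * ⟪φ x₆, v₆⟫_ℝ + ⟪φ x₅, v₅⟫_ℝ * l₆))) with hg'
  have eg : ExpGrowth g :=
    (ExpGrowth.inner_apply x₂ v₂).mul ((ExpGrowth.inner_apply x₃ v₃).mul ((ExpGrowth.inner_apply x₄ v₄).mul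
      ((ExpGrowth.inner_apply x₅ v₅).mul (ExpGrowth.inner_apply x₆ v₆))))
  have eg' : ExpGrowth g' :=
    ((ExpGrowth.const l₂).mul ((ExpGrowth.inner_apply x₃ v₃).mul ((ExpGrowth.inner_apply x₄ v₄).mul
      ((ExpGrowth.inner_apply x₅ v₅).mul (ExpGrowth.inner_apply x₆ v₆))))).add
    ((ExpGrowth.inner_apply x₂ v₂).mul
      (((ExpGrowth.const l₃).mul ((ExpGrowth.inner_apply x₄ v₄).mul
        ((ExpGrowth.inner_apply x₅ v₅).mul (ExpGrowth.inner_apply x₆ v₆)))).add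
      ((ExpGrowth.inner_apply x₃ v₃).mul
        (((ExpGrowth.const l₄).mul ((ExpGrowth.inner_apply x₅ v₅).mul (ExpGrowth.inner_apply x₆ v₆))).add
        ((ExpGrowth.inner_apply x₄ v₄).mul
          (((ExpGrowth.const l₅).mul (ExpGrowth.inner_apply x₆ v₆)).add
          ((ExpGrowth.inner_apply x₅ v₅).mul (ExpGrowth.const l₆))))))))
  obtain ⟨K, κ, hκ, hgb, hg'b⟩ := eg.common eg'
  have hmain := gaussIBP C η w c M2 hw hM h g g' (fun φ s =>
      (hasDerivAt_inner_transl φ h x₂ v₂ s).mul ((hasDerivAt_inner_transl φ h x₃ v₃ s).mul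
        ((hasDerivAt_inner_transl φ h x₄ v₄ s).mul ((hasDerivAt_inner_transl φ h x₅ v₅ s).mul
          (hasDerivAt_inner_transl φ h x₆ v₆ s))))) eg.1 eg'.1 hκ hgb hg'b
  -- left side: `ℓ₁ = ⟨φ, K h⟩`
  have hlhs : (fun φ : Cfg P j N => weight C η w c M2 (0 : VecField P j ℝ) φ *
      (⟪φ x₁, v₁⟫_ℝ * (⟪φ x₂, v₂⟫_ℝ * (⟪φ x₃, v₃⟫_ℝ * (⟪φ x₄, v₄⟫_ℝ * (⟪φ x₅, v₅⟫_ℝ * ⟪φ x₆, v₆⟫_ℝ)))))) =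
      fun φ => weight C η w c M2 (0 : VecField P j ℝ) φ * (Kbil w c M2 φ h * g φ) := by
    funext φ
    rw [hh, Kbil_gcol w c M2 hw hM]
  rw [hlhs, hmain]
  -- right side: split `∫ W g'` into the five four-field integrals
  have i3456 := (((ExpGrowth.inner_apply x₃ v₃).mul ((ExpGrowth.inner_apply x₄ v₄).mul
      ((ExpGrowth.inner_apply x₅ v₅).mul (ExpGrowth.inner_apply x₆ v₆)))).const_mul l₂).integrable C η w c M2 hw hM
  have i2456 := (((ExpGrowth.inner_apply x₂ v₂).mul ((ExpGrowth.inner_apply x₄ v₄).mul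
      ((ExpGrowth.inner_apply x₅ v₅).mul (ExpGrowth.inner_apply x₆ v₆)))).const_mul l₃).integrable C η w c M2 hw hM
  have i2356 := (((ExpGrowth.inner_apply x₂ v₂).mul ((ExpGrowth.inner_apply x₃ v₃).mul
      ((ExpGrowth.inner_apply x₅ v₅).mul (ExpGrowth.inner_apply x₆ v₆)))).const_mul l₄).integrable C η w c M2 hw hM
  have i2346 := (((ExpGrowth.inner_apply x₂ v₂).mul ((ExpGrowth.inner_apply x₃ v₃).mul
      ((ExpGrowth.inner_apply x₄ v₄).mul (ExpGrowth.inner_apply x₆ v₆)))).const_mul l₅).integrable C η w c M2 hw hM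
  have i2345 := (((ExpGrowth.inner_apply x₂ v₂).mul ((ExpGrowth.inner_apply x₃ v₃).mul
      ((ExpGrowth.inner_apply x₄ v₄).mul (ExpGrowth.inner_apply x₅ v₅)))).const_mul l₆).integrable C η w c M2 hw hM
  have i12 : Integrable (fun φ : Cfg P j N =>
      weight C η w c M2 (0 : VecField P j ℝ) φ * (l₂ * (⟪φ x₃, v₃⟫_ℝ * (⟪φ x₄, v₄⟫_ℝ * (⟪φ x₅, v₅⟫_ℝ * ⟪φ x₆, v₆⟫_ℝ))))
      + weight C η w c M2 (0 : VecField P j ℝ) φ * (l₃ * (⟪φ x₂, v₂⟫_ℝ * (⟪φ x₄, v₄⟫_ℝ * (⟪φ x₅, v₅⟫_ℝ * ⟪φ x₆, v₆⟫_ℝ))))) := i3456.add i2456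
  have i123 : Integrable (fun φ : Cfg P j N =>
      weight C η w c M2 (0 : VecField P j ℝ) φ * (l₂ * (⟪φ x₃, v₃⟫_ℝ * (⟪φ x₄, v₄⟫_ℝ * (⟪φ x₅, v₅⟫_ℝ * ⟪φ x₆, v₆⟫_ℝ))))
      + weight C η w c M2 (0 : VecField P j ℝ) φ * (l₃ * (⟪φ x₂, v₂⟫_ℝ * (⟪φ x₄, v₄⟫_ℝ * (⟪φ x₅, v₅⟫_ℝ * ⟪φ x₆, v₆⟫_ℝ))))
      + weight C η w c M2 (0 : VecField P j ℝ) φ * (l₄ * (⟪φ x₂, v₂⟫_ℝ * (⟪φ x₃, v₃⟫_ℝ * (⟪φ x₅, v₅⟫_ℝ * ⟪φ x₆, v₆⟫_ℝ))))) := i12.add i2356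
  have i1234 : Integrable (fun φ : Cfg P j N =>
      weight C η w c M2 (0 : VecField P j ℝ) φ * (l₂ * (⟪φ x₃, v₃⟫_ℝ * (⟪φ x₄, v₄⟫_ℝ * (⟪φ x₅, v₅⟫_ℝ * ⟪φ x₆, v₆⟫_ℝ))))
      + weight C η w c M2 (0 : VecField P j ℝ) φ * (l₃ * (⟪φ x₂, v₂⟫_ℝ * (⟪φ x₄, v₄⟫_ℝ * (⟪φ x₅, v₅⟫_ℝ * ⟪φ x₆, v₆⟫_ℝ))))
      + weight C η w c M2 (0 : VecField P j ℝ) φ * (l₄ * (⟪φ x₂, v₂⟫_ℝ * (⟪φ x₃, v₃⟫_ℝ * (⟪φ x₅, v₅⟫_ℝ * ⟪φ x₆, v₆⟫_ℝ))))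
      + weight C η w c M2 (0 : VecField P j ℝ) φ * (l₅ * (⟪φ x₂, v₂⟫_ℝ * (⟪φ x₃, v₃⟫_ℝ * (⟪φ x₄, v₄⟫_ℝ * ⟪φ x₆, v₆⟫_ℝ))))) := i123.add i2346
  have hsplit : (fun φ : Cfg P j N => weight C η w c M2 (0 : VecField P j ℝ) φ * g' φ) = fun φ =>
      weight C η w c M2 (0 : VecField P j ℝ) φ * (l₂ * (⟪φ x₃, v₃⟫_ℝ * (⟪φ x₄, v₄⟫_ℝ * (⟪φ x₅, v₅⟫_ℝ * ⟪φ x₆, v₆⟫_ℝ))))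
      + weight C η w c M2 (0 : VecField P j ℝ) φ * (l₃ * (⟪φ x₂, v₂⟫_ℝ * (⟪φ x₄, v₄⟫_ℝ * (⟪φ x₅, v₅⟫_ℝ * ⟪φ x₆, v₆⟫_ℝ))))
      + weight C η w c M2 (0 : VecField P j ℝ) φ * (l₄ * (⟪φ x₂, v₂⟫_ℝ * (⟪φ x₃, v₃⟫_ℝ * (⟪φ x₅, v₅⟫_ℝ * ⟪φ x₆, v₆⟫_ℝ))))
      + weight C η w c M2 (0 : VecField P j ℝ) φ * (l₅ * (⟪φ x₂, v₂⟫_ℝ * (⟪φ x₃, v₃⟫_ℝ * (⟪φ x₄, v₄⟫_ℝ * ⟪φ x₆, v₆⟫_ℝ))))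
      + weight C η w c M2 (0 : VecField P j ℝ) φ * (l₆ * (⟪φ x₂, v₂⟫_ℝ * (⟪φ x₃, v₃⟫_ℝ * (⟪φ x₄, v₄⟫_ℝ * ⟪φ x₅, v₅⟫_ℝ)))) := by
    funext φ
    simp only [hg']
    ring
  rw [hsplit, integral_add i1234 i2345, integral_add i123 i2346, integral_add i12 i2356, integral_add i3456 i2456]
  have pull : ∀ (l : ℝ) (F : Cfg P j N → ℝ), (∫ φ, weight C η w c M2 (0 : VecField P j ℝ) φ * (l * F φ)) =
      l * ∫ φ, weight C η w c M2 (0 : VecField P j ℝ) φ * F φ := fun l F => by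
    rw [← integral_const_mul]
    exact integral_congr_ae (Filter.Eventually.of_forall fun φ => by ring)
  rw [pull, pull, pull, pull, pull]
  simp only [hl₂, hl₃, hl₄, hl₅, hl₆, hh, gcol, real_inner_smul_left]
  rw [G_symm w c M2 x₂ x₁, G_symm w c M2 x₃ x₁, G_symm w c M2 x₄ x₁, G_symm w c M2 x₅ x₁, G_symm w c M2 x₆ x₁]

/-- the three pairings of four bond components: `pair3(b₁,b₂,b₃,b₄) = cv₁₂cv₃₄ + cv₁₃cv₂₄ + cv₁₄cv₂₃` (`⟨A_{b₁}A_{b₂}A_{b₃}A_{b₄}⟩/Z_A`,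
BRICK 21 `integral_WA_toVec_four`). [cite: Balaban1983Higgs3, (1.21) p.416, (2.26) p.431] -/
def pair3 (b₁ b₂ b₃ b₄ : PBond P j) : ℝ :=
  cv w c μ2 b₁ b₂ * cv w c μ2 b₃ b₄ + cv w c μ2 b₁ b₃ * cv w c μ2 b₂ b₄ + cv w c μ2 b₁ b₄ * cv w c μ2 b₂ b₃

/-- the fifteen pairings of six bond components, by the Wick recursion on the first leg:
`pair15(b₁,…,b₆) = Σ_{m=2}^{6} cv(b₁,b_m)·pair3(the other four)` (`⟨A_{b₁}⋯A_{b₆}⟩/Z_A`). [cite: Balaban1983Higgs3, (1.21) p.416, (2.26) p.431] -/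
def pair15 (b₁ b₂ b₃ b₄ b₅ b₆ : PBond P j) : ℝ :=
  cv w c μ2 b₁ b₂ * pair3 w c μ2 b₃ b₄ b₅ b₆ + cv w c μ2 b₁ b₃ * pair3 w c μ2 b₂ b₄ b₅ b₆
    + cv w c μ2 b₁ b₄ * pair3 w c μ2 b₂ b₃ b₅ b₆ + cv w c μ2 b₁ b₅ * pair3 w c μ2 b₂ b₃ b₄ b₆
    + cv w c μ2 b₁ b₆ * pair3 w c μ2 b₂ b₃ b₄ b₅

omit C m2 in
/-- the orthonormality of the component directions. [folklore] -/
private theorem inner_basisFun_dir' (b b' : PBond P j) :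
    ⟪EuclideanSpace.basisFun (Fin P.d) ℝ b.dir, EuclideanSpace.basisFun (Fin P.d) ℝ b'.dir⟫_ℝ =
      if b.dir = b'.dir then 1 else 0 := by
  classical
  exact orthonormal_iff_ite.mp (EuclideanSpace.basisFun (Fin P.d) ℝ).orthonormal _ _

omit C m2 in
/-- BRICK 21's fourth moments in `pair3` form. [cite: Balaban1983Higgs3, (1.21) p.416, (2.26) p.431] -/
theorem integral_WA_toVec_four' (hw : 0 < w) (hμ : 0 < μ2) (b₁ b₂ b₃ b₄ : PBond P j) :
    ∫ A : Cfg P j P.d, WA η w c μ2 A * (toVec A b₁ * (toVec A b₂ * (toVec A b₃ * toVec A b₄))) =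
      (∫ A : Cfg P j P.d, WA η w c μ2 A) * pair3 w c μ2 b₁ b₂ b₃ b₄ := by
  rw [integral_WA_toVec_four η w c μ2 hw hμ, pair3]

omit C m2 in
/-- **THE SIXTH MOMENTS OF THE FREE VECTOR FIELD (Wick, fifteen pairings)**: `⟨A_{b₁}⋯A_{b₆}⟩ = Z_A·pair15(b₁,…,b₆)` — the
recursion `moment6_step` at `N := d` with the legs `⟪A(b₋),e_{μ_b}⟫ = A_b`, closed by BRICK 21's fourth moments.
[cite: Balaban1983Higgs3, (1.21) p.416, (2.26) p.431] -/
theorem integral_WA_toVec_six (hw : 0 < w) (hμ : 0 < μ2) (b₁ b₂ b₃ b₄ b₅ b₆ : PBond P j) :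
    ∫ A : Cfg P j P.d, WA η w c μ2 A *
        (toVec A b₁ * (toVec A b₂ * (toVec A b₃ * (toVec A b₄ * (toVec A b₅ * toVec A b₆))))) =
      (∫ A : Cfg P j P.d, WA η w c μ2 A) * pair15 w c μ2 b₁ b₂ b₃ b₄ b₅ b₆ := by
  have h4 := integral_WA_toVec_four' (P := P) (j := j) η w c μ2 hw hμ
  unfold WA toVec at h4 ⊢
  rw [moment6_step (Cvec P.d) η w c μ2 hw hμ]
  simp only [h4, inner_basisFun_dir', pair15, cv]
  ring


/-! ## §2 The moments of the eleven sixth-degree shapes of `D^M_6(0)` (bond sums `Σ_bκ_bA_bⁱ` and their products) -/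

section Shapes

variable {w μ2}

omit C η m2 in
/-- products of three bond sums, expanded. [folklore] -/
private theorem sum_mul₃ (f g h : PBond P j → ℝ) :
    (∑ b, f b) * (∑ b, g b) * (∑ b, h b) = ∑ b, ∑ b', ∑ b'', f b * g b' * h b'' := by
  rw [Finset.sum_mul_sum, Finset.sum_mul]
  refine Finset.sum_congr rfl fun b _ => ?_
  rw [Finset.sum_mul]
  refine Finset.sum_congr rfl fun b' _ => ?_
  rw [Finset.mul_sum]

omit C η m2 in
/-- products of four bond sums, expanded. [folklore] -/
private theorem sum_mul₄ (f g h k : PBond P j → ℝ) :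
    (∑ b, f b) * (∑ b, g b) * (∑ b, h b) * (∑ b, k b) = ∑ b₁, ∑ b₂, ∑ b₃, ∑ b₄, f b₁ * g b₂ * h b₃ * k b₄ := by
  rw [sum_mul₃, Finset.sum_mul]
  refine Finset.sum_congr rfl fun b₁ _ => ?_
  rw [Finset.sum_mul]
  refine Finset.sum_congr rfl fun b₂ _ => ?_
  rw [Finset.sum_mul]
  refine Finset.sum_congr rfl fun b₃ _ => ?_
  rw [Finset.mul_sum]

omit C η m2 in
/-- products of five bond sums, expanded. [folklore] -/
private theorem sum_mul₅ (f g h k l : PBond P j → ℝ) :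
    (∑ b, f b) * (∑ b, g b) * (∑ b, h b) * (∑ b, k b) * (∑ b, l b) =
      ∑ b₁, ∑ b₂, ∑ b₃, ∑ b₄, ∑ b₅, f b₁ * g b₂ * h b₃ * k b₄ * l b₅ := by
  rw [sum_mul₄, Finset.sum_mul]
  refine Finset.sum_congr rfl fun b₁ _ => ?_
  rw [Finset.sum_mul]
  refine Finset.sum_congr rfl fun b₂ _ => ?_
  rw [Finset.sum_mul]
  refine Finset.sum_congr rfl fun b₃ _ => ?_
  rw [Finset.sum_mul]
  refine Finset.sum_congr rfl fun b₄ _ => ?_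
  rw [Finset.mul_sum]

omit C η m2 in
/-- products of six bond sums, expanded. [folklore] -/
private theorem sum_mul₆ (f g h k l m : PBond P j → ℝ) :
    (∑ b, f b) * (∑ b, g b) * (∑ b, h b) * (∑ b, k b) * (∑ b, l b) * (∑ b, m b) =
      ∑ b₁, ∑ b₂, ∑ b₃, ∑ b₄, ∑ b₅, ∑ b₆, f b₁ * g b₂ * h b₃ * k b₄ * l b₅ * m b₆ := by
  rw [sum_mul₅, Finset.sum_mul]
  refine Finset.sum_congr rfl fun b₁ _ => ?_
  rw [Finset.sum_mul]
  refine Finset.sum_congr rfl fun b₂ _ => ?_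
  rw [Finset.sum_mul]
  refine Finset.sum_congr rfl fun b₃ _ => ?_
  rw [Finset.sum_mul]
  refine Finset.sum_congr rfl fun b₄ _ => ?_
  rw [Finset.sum_mul]
  refine Finset.sum_congr rfl fun b₅ _ => ?_
  rw [Finset.mul_sum]

variable (hw : 0 < w) (hμ : 0 < μ2)
include hw hμ

omit C m2 in
/-- `⟨A_{b₁}⋯A_{b₆}⟩`. [cite: Balaban1983Higgs3, (1.21) p.416, (2.26) p.431] -/
theorem wai_six (b₁ b₂ b₃ b₄ b₅ b₆ : PBond P j) :
    WAI η w c μ2 (fun A => toVec A b₁ * (toVec A b₂ * (toVec A b₃ * (toVec A b₄ * (toVec A b₅ * toVec A b₆)))))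
      (pair15 w c μ2 b₁ b₂ b₃ b₄ b₅ b₆) :=
  WAI.of_expGrowth hw hμ ((expGrowth_toVec b₁).mul ((expGrowth_toVec b₂).mul ((expGrowth_toVec b₃).mul
    ((expGrowth_toVec b₄).mul ((expGrowth_toVec b₅).mul (expGrowth_toVec b₆))))))
    (integral_WA_toVec_six η w c μ2 hw hμ b₁ b₂ b₃ b₄ b₅ b₆)

omit C m2 in
/-- shape `h₆`: `⟨Σ_bκ_bA_b⁶⟩/Z_A = Σ_bκ_b·pair15(b,b,b,b,b,b)` (`= 15Σκ_bcv(b,b)³`). [cite: Balaban1983Higgs3, (1.21) p.416, (2.26) p.431] -/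
theorem wai_sum_pow_six (κ : PBond P j → ℝ) :
    WAI η w c μ2 (fun A => ∑ b, κ b * toVec A b ^ 6) (∑ b, κ b * pair15 w c μ2 b b b b b b) :=
  WAI.sum η c _ hw hμ fun b _ => ((wai_six η c hw hμ b b b b b b).const_mul (κ b)).congr (fun A => by ring) rfl

omit C m2 in
/-- shape `h₁h₅`. [cite: Balaban1983Higgs3, (1.21) p.416, (2.26) p.431] -/
theorem wai_s1_s5 (κ κ' : PBond P j → ℝ) :
    WAI η w c μ2 (fun A => (∑ b, κ b * toVec A b) * (∑ b, κ' b * toVec A b ^ 5))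
      (∑ b, ∑ b', κ b * κ' b' * pair15 w c μ2 b b' b' b' b' b') := by
  have h := WAI.sum η c (Finset.univ : Finset (PBond P j)) hw hμ fun b _ =>
    WAI.sum η c (Finset.univ : Finset (PBond P j)) hw hμ fun b' _ => (wai_six η c hw hμ b b' b' b' b' b').const_mul (κ b * κ' b')
  refine h.congr (fun A => ?_) rfl
  rw [Finset.sum_mul_sum]
  exact Finset.sum_congr rfl fun b _ => Finset.sum_congr rfl fun b' _ => by ring

omit C m2 in
/-- shape `h₂h₄`. [cite: Balaban1983Higgs3, (1.21) p.416, (2.26) p.431] -/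
theorem wai_s2_s4 (κ κ' : PBond P j → ℝ) :
    WAI η w c μ2 (fun A => (∑ b, κ b * toVec A b ^ 2) * (∑ b, κ' b * toVec A b ^ 4))
      (∑ b, ∑ b', κ b * κ' b' * pair15 w c μ2 b b b' b' b' b') := by
  have h := WAI.sum η c (Finset.univ : Finset (PBond P j)) hw hμ fun b _ =>
    WAI.sum η c (Finset.univ : Finset (PBond P j)) hw hμ fun b' _ => (wai_six η c hw hμ b b b' b' b' b').const_mul (κ b * κ' b')
  refine h.congr (fun A => ?_) rfl
  rw [Finset.sum_mul_sum]
  exact Finset.sum_congr rfl fun b _ => Finset.sum_congr rfl fun b' _ => by ring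

omit C m2 in
/-- shape `h₃h₃`. [cite: Balaban1983Higgs3, (1.21) p.416, (2.26) p.431] -/
theorem wai_s3_s3 (κ κ' : PBond P j → ℝ) :
    WAI η w c μ2 (fun A => (∑ b, κ b * toVec A b ^ 3) * (∑ b, κ' b * toVec A b ^ 3))
      (∑ b, ∑ b', κ b * κ' b' * pair15 w c μ2 b b b b' b' b') := by
  have h := WAI.sum η c (Finset.univ : Finset (PBond P j)) hw hμ fun b _ =>
    WAI.sum η c (Finset.univ : Finset (PBond P j)) hw hμ fun b' _ => (wai_six η c hw hμ b b b b' b' b').const_mul (κ b * κ' b')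
  refine h.congr (fun A => ?_) rfl
  rw [Finset.sum_mul_sum]
  exact Finset.sum_congr rfl fun b _ => Finset.sum_congr rfl fun b' _ => by ring

omit C m2 in
/-- shape `h₁h₁h₄`. [cite: Balaban1983Higgs3, (1.21) p.416, (2.26) p.431] -/
theorem wai_s1_s1_s4 (κ κ' κ'' : PBond P j → ℝ) :
    WAI η w c μ2 (fun A => (∑ b, κ b * toVec A b) * (∑ b, κ' b * toVec A b) * (∑ b, κ'' b * toVec A b ^ 4))
      (∑ b, ∑ b', ∑ b'', κ b * κ' b' * κ'' b'' * pair15 w c μ2 b b' b'' b'' b'' b'') := by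
  have h := WAI.sum η c (Finset.univ : Finset (PBond P j)) hw hμ fun b _ =>
    WAI.sum η c (Finset.univ : Finset (PBond P j)) hw hμ fun b' _ =>
      WAI.sum η c (Finset.univ : Finset (PBond P j)) hw hμ fun b'' _ =>
        (wai_six η c hw hμ b b' b'' b'' b'' b'').const_mul (κ b * κ' b' * κ'' b'')
  refine h.congr (fun A => ?_) rfl
  rw [sum_mul₃]
  exact Finset.sum_congr rfl fun _ _ => Finset.sum_congr rfl fun _ _ => Finset.sum_congr rfl fun _ _ => by ring

omit C m2 in
/-- shape `h₁h₂h₃`. [cite: Balaban1983Higgs3, (1.21) p.416, (2.26) p.431] -/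
theorem wai_s1_s2_s3 (κ κ' κ'' : PBond P j → ℝ) :
    WAI η w c μ2 (fun A => (∑ b, κ b * toVec A b) * (∑ b, κ' b * toVec A b ^ 2) * (∑ b, κ'' b * toVec A b ^ 3))
      (∑ b, ∑ b', ∑ b'', κ b * κ' b' * κ'' b'' * pair15 w c μ2 b b' b' b'' b'' b'') := by
  have h := WAI.sum η c (Finset.univ : Finset (PBond P j)) hw hμ fun b _ =>
    WAI.sum η c (Finset.univ : Finset (PBond P j)) hw hμ fun b' _ =>
      WAI.sum η c (Finset.univ : Finset (PBond P j)) hw hμ fun b'' _ =>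
        (wai_six η c hw hμ b b' b' b'' b'' b'').const_mul (κ b * κ' b' * κ'' b'')
  refine h.congr (fun A => ?_) rfl
  rw [sum_mul₃]
  exact Finset.sum_congr rfl fun _ _ => Finset.sum_congr rfl fun _ _ => Finset.sum_congr rfl fun _ _ => by ring

omit C m2 in
/-- shape `h₂h₂h₂`. [cite: Balaban1983Higgs3, (1.21) p.416, (2.26) p.431] -/
theorem wai_s2_s2_s2 (κ κ' κ'' : PBond P j → ℝ) :
    WAI η w c μ2 (fun A => (∑ b, κ b * toVec A b ^ 2) * (∑ b, κ' b * toVec A b ^ 2) * (∑ b, κ'' b * toVec A b ^ 2))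
      (∑ b, ∑ b', ∑ b'', κ b * κ' b' * κ'' b'' * pair15 w c μ2 b b b' b' b'' b'') := by
  have h := WAI.sum η c (Finset.univ : Finset (PBond P j)) hw hμ fun b _ =>
    WAI.sum η c (Finset.univ : Finset (PBond P j)) hw hμ fun b' _ =>
      WAI.sum η c (Finset.univ : Finset (PBond P j)) hw hμ fun b'' _ =>
        (wai_six η c hw hμ b b b' b' b'' b'').const_mul (κ b * κ' b' * κ'' b'')
  refine h.congr (fun A => ?_) rfl
  rw [sum_mul₃]
  exact Finset.sum_congr rfl fun _ _ => Finset.sum_congr rfl fun _ _ => Finset.sum_congr rfl fun _ _ => by ring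

omit C m2 in
/-- shape `h₁h₁h₁h₃`. [cite: Balaban1983Higgs3, (1.21) p.416, (2.26) p.431] -/
theorem wai_s1_s1_s1_s3 (κ κ' κ'' κ''' : PBond P j → ℝ) :
    WAI η w c μ2 (fun A => (∑ b, κ b * toVec A b) * (∑ b, κ' b * toVec A b) * (∑ b, κ'' b * toVec A b) *
        (∑ b, κ''' b * toVec A b ^ 3))
      (∑ b₁, ∑ b₂, ∑ b₃, ∑ b₄, κ b₁ * κ' b₂ * κ'' b₃ * κ''' b₄ * pair15 w c μ2 b₁ b₂ b₃ b₄ b₄ b₄) := by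
  have h := WAI.sum η c (Finset.univ : Finset (PBond P j)) hw hμ fun b₁ _ =>
    WAI.sum η c (Finset.univ : Finset (PBond P j)) hw hμ fun b₂ _ =>
      WAI.sum η c (Finset.univ : Finset (PBond P j)) hw hμ fun b₃ _ =>
        WAI.sum η c (Finset.univ : Finset (PBond P j)) hw hμ fun b₄ _ =>
          (wai_six η c hw hμ b₁ b₂ b₃ b₄ b₄ b₄).const_mul (κ b₁ * κ' b₂ * κ'' b₃ * κ''' b₄)
  refine h.congr (fun A => ?_) rfl
  rw [sum_mul₄]
  exact Finset.sum_congr rfl fun _ _ => Finset.sum_congr rfl fun _ _ => Finset.sum_congr rfl fun _ _ =>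
    Finset.sum_congr rfl fun _ _ => by ring

omit C m2 in
/-- shape `h₁h₁h₂h₂`. [cite: Balaban1983Higgs3, (1.21) p.416, (2.26) p.431] -/
theorem wai_s1_s1_s2_s2 (κ κ' κ'' κ''' : PBond P j → ℝ) :
    WAI η w c μ2 (fun A => (∑ b, κ b * toVec A b) * (∑ b, κ' b * toVec A b) * (∑ b, κ'' b * toVec A b ^ 2) *
        (∑ b, κ''' b * toVec A b ^ 2))
      (∑ b₁, ∑ b₂, ∑ b₃, ∑ b₄, κ b₁ * κ' b₂ * κ'' b₃ * κ''' b₄ * pair15 w c μ2 b₁ b₂ b₃ b₃ b₄ b₄) := by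
  have h := WAI.sum η c (Finset.univ : Finset (PBond P j)) hw hμ fun b₁ _ =>
    WAI.sum η c (Finset.univ : Finset (PBond P j)) hw hμ fun b₂ _ =>
      WAI.sum η c (Finset.univ : Finset (PBond P j)) hw hμ fun b₃ _ =>
        WAI.sum η c (Finset.univ : Finset (PBond P j)) hw hμ fun b₄ _ =>
          (wai_six η c hw hμ b₁ b₂ b₃ b₃ b₄ b₄).const_mul (κ b₁ * κ' b₂ * κ'' b₃ * κ''' b₄)
  refine h.congr (fun A => ?_) rfl
  rw [sum_mul₄]
  exact Finset.sum_congr rfl fun _ _ => Finset.sum_congr rfl fun _ _ => Finset.sum_congr rfl fun _ _ =>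
    Finset.sum_congr rfl fun _ _ => by ring

omit C m2 in
/-- shape `h₁⁴h₂`. [cite: Balaban1983Higgs3, (1.21) p.416, (2.26) p.431] -/
theorem wai_s1_pow_four_s2 (κ κ' : PBond P j → ℝ) :
    WAI η w c μ2 (fun A => (∑ b, κ b * toVec A b) ^ 4 * (∑ b, κ' b * toVec A b ^ 2))
      (∑ b₁, ∑ b₂, ∑ b₃, ∑ b₄, ∑ b₅, κ b₁ * κ b₂ * κ b₃ * κ b₄ * κ' b₅ * pair15 w c μ2 b₁ b₂ b₃ b₄ b₅ b₅) := by
  have h := WAI.sum η c (Finset.univ : Finset (PBond P j)) hw hμ fun b₁ _ =>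
    WAI.sum η c (Finset.univ : Finset (PBond P j)) hw hμ fun b₂ _ =>
      WAI.sum η c (Finset.univ : Finset (PBond P j)) hw hμ fun b₃ _ =>
        WAI.sum η c (Finset.univ : Finset (PBond P j)) hw hμ fun b₄ _ =>
          WAI.sum η c (Finset.univ : Finset (PBond P j)) hw hμ fun b₅ _ =>
            (wai_six η c hw hμ b₁ b₂ b₃ b₄ b₅ b₅).const_mul (κ b₁ * κ b₂ * κ b₃ * κ b₄ * κ' b₅)
  refine h.congr (fun A => ?_) rfl
  have e : (∑ b, κ b * toVec A b) ^ 4 * (∑ b, κ' b * toVec A b ^ 2) =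
      (∑ b, κ b * toVec A b) * (∑ b, κ b * toVec A b) * (∑ b, κ b * toVec A b) * (∑ b, κ b * toVec A b) *
        (∑ b, κ' b * toVec A b ^ 2) := by ring
  rw [e, sum_mul₅]
  exact Finset.sum_congr rfl fun _ _ => Finset.sum_congr rfl fun _ _ => Finset.sum_congr rfl fun _ _ =>
    Finset.sum_congr rfl fun _ _ => Finset.sum_congr rfl fun _ _ => by ring

omit C m2 in
/-- shape `h₁⁶`: six cubic vertices, fifteen pairings. [cite: Balaban1983Higgs3, (1.21) p.416, (2.26) p.431] -/
theorem wai_s1_pow_six (κ : PBond P j → ℝ) :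
    WAI η w c μ2 (fun A => (∑ b, κ b * toVec A b) ^ 6)
      (∑ b₁, ∑ b₂, ∑ b₃, ∑ b₄, ∑ b₅, ∑ b₆, κ b₁ * κ b₂ * κ b₃ * κ b₄ * κ b₅ * κ b₆ * pair15 w c μ2 b₁ b₂ b₃ b₄ b₅ b₆) := by
  have h := WAI.sum η c (Finset.univ : Finset (PBond P j)) hw hμ fun b₁ _ =>
    WAI.sum η c (Finset.univ : Finset (PBond P j)) hw hμ fun b₂ _ =>
      WAI.sum η c (Finset.univ : Finset (PBond P j)) hw hμ fun b₃ _ =>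
        WAI.sum η c (Finset.univ : Finset (PBond P j)) hw hμ fun b₄ _ =>
          WAI.sum η c (Finset.univ : Finset (PBond P j)) hw hμ fun b₅ _ =>
            WAI.sum η c (Finset.univ : Finset (PBond P j)) hw hμ fun b₆ _ =>
              (wai_six η c hw hμ b₁ b₂ b₃ b₄ b₅ b₆).const_mul (κ b₁ * κ b₂ * κ b₃ * κ b₄ * κ b₅ * κ b₆)
  refine h.congr (fun A => ?_) rfl
  have e : (∑ b, κ b * toVec A b) ^ 6 =
      (∑ b, κ b * toVec A b) * (∑ b, κ b * toVec A b) * (∑ b, κ b * toVec A b) * (∑ b, κ b * toVec A b) *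
        (∑ b, κ b * toVec A b) * (∑ b, κ b * toVec A b) := by ring
  rw [e, sum_mul₆]
  exact Finset.sum_congr rfl fun _ _ => Finset.sum_congr rfl fun _ _ => Finset.sum_congr rfl fun _ _ =>
    Finset.sum_congr rfl fun _ _ => Finset.sum_congr rfl fun _ _ => Finset.sum_congr rfl fun _ _ => by ring

end Shapes


/-! ## §3 `D^M_6 = f₆ + 6f₁f₅ + 15f₂f₄ + 10f₃² + 15f₁²f₄ + 60f₁f₂f₃ + 15f₂³ + 20f₁³f₃ + 45f₁²f₂² + 15f₁⁴f₂ + f₁⁶` (the complete Bell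
polynomial `B₆`, BRICK 21 `eval_Dpoly_six`) and THE VECTOR FIELD INTEGRATED OUT OF `D^M_6(0)`: the polynomial `P₆` -/

omit m2 μ2 in
/-- `D^M_6 = B₆(f₁,…,f₆)`. [cite: Balaban1983Higgs3, (1.20) p.416] [cite: GlimmJaffeQP1987, (9.1.3)] -/
theorem DkM_six (cts : ℕ → ℝ → ℝ) (e : ℝ) (A : VecField P j ℝ) (φ : Cfg P j N) :
    DkM C η w c cts 6 e A φ =
      fM C η w c cts 6 e A φ + 6 * (fM C η w c cts 1 e A φ * fM C η w c cts 5 e A φ)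
      + 15 * (fM C η w c cts 2 e A φ * fM C η w c cts 4 e A φ) + 10 * fM C η w c cts 3 e A φ ^ 2
      + 15 * (fM C η w c cts 1 e A φ ^ 2 * fM C η w c cts 4 e A φ)
      + 60 * (fM C η w c cts 1 e A φ * fM C η w c cts 2 e A φ * fM C η w c cts 3 e A φ)
      + 15 * fM C η w c cts 2 e A φ ^ 3 + 20 * (fM C η w c cts 1 e A φ ^ 3 * fM C η w c cts 3 e A φ)
      + 45 * (fM C η w c cts 1 e A φ ^ 2 * fM C η w c cts 2 e A φ ^ 2)
      + 15 * (fM C η w c cts 1 e A φ ^ 4 * fM C η w c cts 2 e A φ) + fM C η w c cts 1 e A φ ^ 6 := by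
  unfold DkM
  exact eval_Dpoly_six _

/-- **THE VECTOR FIELD INTEGRATED OUT OF `D^M_6(0)`** — the polynomial `P₆(φ) = ⟨D^M_6(0;·,φ)⟩_A/Z_A` in the scalar field, term by
term from `B₆(f₁,…,f₆)` with `f₁ = h₁`, `f₃ = h₃`, `f₅ = h₅`, `f₂ = h₂ − ½ct″(0)Q`, `f₄ = h₄ − ½ct⁗(0)Q`, `f₆ = h₆ − ½ct⁽⁶⁾(0)Q`
(`Q = Σ_xη^d∣φ(x)∣²`, `h_i(0) = Σ_bκ_i(φ;b)A_bⁱ`) and the vector-Gaussian moments: the eleven sixth-degree shapes `h₆, h₁h₅, h₂h₄, h₃²,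
h₁²h₄, h₁h₂h₃, h₂³, h₁³h₃, h₁²h₂², h₁⁴h₂, h₁⁶` against the fifteen pairings `pair15`, the fourth-degree shapes of BRICK 21 against the
mass-counterterm bubbles, and the pure bubbles — the vertices (1.8)ₙ,₀/(1.10)ₙ,₀, `n ≤ 6`, of total order `e⁶` with their vector legs
contracted in all ways, plus `δm²_{(2,0)}`, `δm²_{(4,0)}` insertions. [cite: Balaban1983Higgs3, (1.21)–(1.22) p.416, (1.23)–(1.24) p.417] -/
def P6 (ct2 ct4 ct6 : ℝ) (φ : Cfg P j N) : ℝ :=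
  (∑ b, kap C η w c 6 φ b * pair15 w c μ2 b b b b b b)
  + 6 * ∑ b, ∑ b', kap C η w c 1 φ b * kap C η w c 5 φ b' * pair15 w c μ2 b b' b' b' b' b'
  + 15 * ∑ b, ∑ b', kap C η w c 2 φ b * kap C η w c 4 φ b' * pair15 w c μ2 b b b' b' b' b'
  + 10 * ∑ b, ∑ b', kap C η w c 3 φ b * kap C η w c 3 φ b' * pair15 w c μ2 b b b b' b' b'
  + 15 * ∑ b, ∑ b', ∑ b'', kap C η w c 1 φ b * kap C η w c 1 φ b' * kap C η w c 4 φ b'' * pair15 w c μ2 b b' b'' b'' b'' b''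
  + 60 * ∑ b, ∑ b', ∑ b'', kap C η w c 1 φ b * kap C η w c 2 φ b' * kap C η w c 3 φ b'' * pair15 w c μ2 b b' b' b'' b'' b''
  + 15 * ∑ b, ∑ b', ∑ b'', kap C η w c 2 φ b * kap C η w c 2 φ b' * kap C η w c 2 φ b'' * pair15 w c μ2 b b b' b' b'' b''
  + 20 * ∑ b₁, ∑ b₂, ∑ b₃, ∑ b₄, kap C η w c 1 φ b₁ * kap C η w c 1 φ b₂ * kap C η w c 1 φ b₃ * kap C η w c 3 φ b₄ *
      pair15 w c μ2 b₁ b₂ b₃ b₄ b₄ b₄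
  + 45 * ∑ b₁, ∑ b₂, ∑ b₃, ∑ b₄, kap C η w c 1 φ b₁ * kap C η w c 1 φ b₂ * kap C η w c 2 φ b₃ * kap C η w c 2 φ b₄ *
      pair15 w c μ2 b₁ b₂ b₃ b₃ b₄ b₄
  + 15 * ∑ b₁, ∑ b₂, ∑ b₃, ∑ b₄, ∑ b₅, kap C η w c 1 φ b₁ * kap C η w c 1 φ b₂ * kap C η w c 1 φ b₃ * kap C η w c 1 φ b₄ *
      kap C η w c 2 φ b₅ * pair15 w c μ2 b₁ b₂ b₃ b₄ b₅ b₅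
  + ∑ b₁, ∑ b₂, ∑ b₃, ∑ b₄, ∑ b₅, ∑ b₆, kap C η w c 1 φ b₁ * kap C η w c 1 φ b₂ * kap C η w c 1 φ b₃ * kap C η w c 1 φ b₄ *
      kap C η w c 1 φ b₅ * kap C η w c 1 φ b₆ * pair15 w c μ2 b₁ b₂ b₃ b₄ b₅ b₆
  + (45 / 4 * ct2 ^ 2 * massForm w φ ^ 2 - 15 / 2 * ct4 * massForm w φ) * ∑ b, kap C η w c 2 φ b * cv w c μ2 b b
  + (45 / 4 * ct2 ^ 2 * massForm w φ ^ 2 - 15 / 2 * ct4 * massForm w φ) *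
      ∑ b, ∑ b', kap C η w c 1 φ b * kap C η w c 1 φ b' * cv w c μ2 b b'
  - 15 / 2 * ct2 * massForm w φ * ∑ b, kap C η w c 4 φ b * (3 * cv w c μ2 b b ^ 2)
  - 30 * ct2 * massForm w φ * ∑ b, ∑ b', kap C η w c 1 φ b * kap C η w c 3 φ b' * (3 * (cv w c μ2 b b' * cv w c μ2 b' b'))
  - 45 / 2 * ct2 * massForm w φ *
      ∑ b, ∑ b', kap C η w c 2 φ b * kap C η w c 2 φ b' * (cv w c μ2 b b * cv w c μ2 b' b' + 2 * cv w c μ2 b b' ^ 2)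
  - 45 * ct2 * massForm w φ * ∑ b, ∑ b', ∑ b'', kap C η w c 1 φ b * kap C η w c 1 φ b' * kap C η w c 2 φ b'' *
      (cv w c μ2 b b' * cv w c μ2 b'' b'' + 2 * (cv w c μ2 b b'' * cv w c μ2 b' b''))
  - 15 / 2 * ct2 * massForm w φ * ∑ b₁, ∑ b₂, ∑ b₃, ∑ b₄,
      kap C η w c 1 φ b₁ * kap C η w c 1 φ b₂ * kap C η w c 1 φ b₃ * kap C η w c 1 φ b₄ *
        (cv w c μ2 b₁ b₂ * cv w c μ2 b₃ b₄ + cv w c μ2 b₁ b₃ * cv w c μ2 b₂ b₄ + cv w c μ2 b₁ b₄ * cv w c μ2 b₂ b₃)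
  - 1 / 2 * ct6 * massForm w φ + 15 / 4 * ct2 * ct4 * massForm w φ ^ 2 - 15 / 8 * ct2 ^ 3 * massForm w φ ^ 3

omit m2 in
/-- **`∫dA W_A(A)·D^M_6(0;A,φ) = Z_A·P₆(φ)`** at every scalar field `φ` (with `ct′(0) = ct‴(0) = ct⁽⁵⁾(0) = 0`).
[cite: Balaban1983Higgs3, (1.21) p.416, (1.24) p.417] -/
theorem wai_DkM_six (hw : 0 < w) (hμ : 0 < μ2) {cts : ℕ → ℝ → ℝ} (h1 : cts 1 0 = 0) (h3 : cts 3 0 = 0) (h5 : cts 5 0 = 0)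
    (φ : Cfg P j N) :
    WAI η w c μ2 (fun A => DkM C η w c cts 6 0 (toVec A) φ) (P6 C η w c μ2 (cts 2 0) (cts 4 0) (cts 6 0) φ) := by
  have h := (((((((((((((((((
      (wai_sum_pow_six η c hw hμ (kap C η w c 6 φ)).add
      ((wai_s1_s5 η c hw hμ (kap C η w c 1 φ) (kap C η w c 5 φ)).const_mul 6)).add
      ((wai_s2_s4 η c hw hμ (kap C η w c 2 φ) (kap C η w c 4 φ)).const_mul 15)).add
      ((wai_s3_s3 η c hw hμ (kap C η w c 3 φ) (kap C η w c 3 φ)).const_mul 10)).add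
      ((wai_s1_s1_s4 η c hw hμ (kap C η w c 1 φ) (kap C η w c 1 φ) (kap C η w c 4 φ)).const_mul 15)).add
      ((wai_s1_s2_s3 η c hw hμ (kap C η w c 1 φ) (kap C η w c 2 φ) (kap C η w c 3 φ)).const_mul 60)).add
      ((wai_s2_s2_s2 η c hw hμ (kap C η w c 2 φ) (kap C η w c 2 φ) (kap C η w c 2 φ)).const_mul 15)).add
      ((wai_s1_s1_s1_s3 η c hw hμ (kap C η w c 1 φ) (kap C η w c 1 φ) (kap C η w c 1 φ) (kap C η w c 3 φ)).const_mul 20)).add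
      ((wai_s1_s1_s2_s2 η c hw hμ (kap C η w c 1 φ) (kap C η w c 1 φ) (kap C η w c 2 φ) (kap C η w c 2 φ)).const_mul 45)).add
      ((wai_s1_pow_four_s2 η c hw hμ (kap C η w c 1 φ) (kap C η w c 2 φ)).const_mul 15)).add
      (wai_s1_pow_six η c hw hμ (kap C η w c 1 φ))).add
      ((wai_sum_sq η c hw hμ (kap C η w c 2 φ)).const_mul
        (45 / 4 * cts 2 0 ^ 2 * massForm w φ ^ 2 - 15 / 2 * cts 4 0 * massForm w φ))).add
      ((wai_sum_mul_sum η c hw hμ (kap C η w c 1 φ) (kap C η w c 1 φ)).const_mul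
        (45 / 4 * cts 2 0 ^ 2 * massForm w φ ^ 2 - 15 / 2 * cts 4 0 * massForm w φ))).sub
      ((wai_sum_pow_four η c hw hμ (kap C η w c 4 φ)).const_mul (15 / 2 * cts 2 0 * massForm w φ))).sub
      ((wai_sum_mul_sum_pow_three η c hw hμ (kap C η w c 1 φ) (kap C η w c 3 φ)).const_mul (30 * cts 2 0 * massForm w φ))).sub
      ((wai_sum_sq_mul_sum_sq η c hw hμ (kap C η w c 2 φ) (kap C η w c 2 φ)).const_mul (45 / 2 * cts 2 0 * massForm w φ))).sub
      ((wai_sum_mul_sum_mul_sum_sq η c hw hμ (kap C η w c 1 φ) (kap C η w c 1 φ) (kap C η w c 2 φ)).const_mul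
        (45 * cts 2 0 * massForm w φ))).sub
      ((wai_sum_pow_four' η c hw hμ (kap C η w c 1 φ)).const_mul (15 / 2 * cts 2 0 * massForm w φ))).add
      (WAI.const η c hw hμ (-(1 / 2 * cts 6 0 * massForm w φ) + 15 / 4 * cts 2 0 * cts 4 0 * massForm w φ ^ 2
        - 15 / 8 * cts 2 0 ^ 3 * massForm w φ ^ 3))
  refine h.congr (fun A => ?_) ?_
  · rw [DkM_six]
    simp only [fM_zero, h1, h3, h5, pow_one]
    ring
  · unfold P6
    ring

omit m2 in
/-- `∫dA W_A·D^M_6(0;A,φ) = Z_A·P₆(φ)`. [cite: Balaban1983Higgs3, (1.21) p.416, (1.24) p.417] -/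
theorem integral_WA_DkM_six (hw : 0 < w) (hμ : 0 < μ2) {cts : ℕ → ℝ → ℝ} (h1 : cts 1 0 = 0) (h3 : cts 3 0 = 0)
    (h5 : cts 5 0 = 0) (φ : Cfg P j N) :
    ∫ A : Cfg P j P.d, WA η w c μ2 A * DkM C η w c cts 6 0 (toVec A) φ =
      (∫ A : Cfg P j P.d, WA η w c μ2 A) * P6 C η w c μ2 (cts 2 0) (cts 4 0) (cts 6 0) φ :=
  (wai_DkM_six C η w c μ2 hw hμ h1 h3 h5 φ).integral_eq

/-! ## §4 THE INDEX `(6,0)` OF (1.24) WITH THE VECTOR FIELD INTEGRATED OUT: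
`∂⁶/∂e⁶ log Z^{ct}∣₀ = ⟨P₆⟩₀ − 15⟨P₂⟩₀⟨P₄⟩₀ + 30⟨P₂⟩₀³` -/

section IndexSixZero

variable {cts : ℕ → ℝ → ℝ} {S : Set ℝ} {Bc : ℝ}

/-- **THE INDEX `(6,0)` OF (1.24) WITH THE VECTOR FIELD INTEGRATED OUT**: along an even counterterm curve with `ct(0) = 0` (BRICK 20 §8's
hypotheses), **`∂⁶/∂e⁶∣₀ log∫dA dφ e^{−S^ε_e} = ⟨P₆⟩₀ − 15⟨P₂⟩₀⟨P₄⟩₀ + 30⟨P₂⟩₀³`**, `⟨·⟩₀` the normalized free scalar expectation at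
mass `m²` and `P₂`, `P₄` (BRICK 21), `P₆` (§3) the explicit polynomials — the order-`e⁶` vacuum term of `E₁` is `(e⁶/6!)·` this; the
scalar Wick theorem on `⟨P₆⟩₀`, `⟨P₄⟩₀`, `⟨P₂⟩₀` (print's *"connected graphs without external legs"* of order `e⁶`) is NOT performed.
[cite: Balaban1983Higgs3, (1.24) p.417, p.418 ("2 ≤ α + 2β ≤ 6")] [cite: GlimmJaffeQP1987, §8.5] -/
theorem iteratedDeriv_six_logZ_massCurve (hw : 0 < w) (hm : 0 < m2) (hμ : 0 < μ2)
    (hct : ∀ (i : ℕ) (e : ℝ), HasDerivAt (cts i) (cts (i + 1) e) e) (hS : IsOpen S) (h0S : (0 : ℝ) ∈ S)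
    (hBc : ∀ (i : ℕ), ∀ e ∈ S, |cts i e| ≤ Bc) (hmass : ∀ e ∈ S, m2 / 2 ≤ m2 + cts 0 e)
    (heven : ∀ e, cts 0 (-e) = cts 0 e) (h00 : cts 0 0 = 0) :
    iteratedDeriv 6 (fun e => Real.log (∫ p : JCfg P j N, J C η w c (m2 + cts 0 e) μ2 e p)) 0 =
      (∫ φ : Cfg P j N, weight C η w c m2 (0 : VecField P j ℝ) φ * P6 C η w c μ2 (cts 2 0) (cts 4 0) (cts 6 0) φ) /
        (∫ φ : Cfg P j N, weight C η w c m2 (0 : VecField P j ℝ) φ)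
      - 15 * ((∫ φ : Cfg P j N, weight C η w c m2 (0 : VecField P j ℝ) φ * P2 C η w c μ2 (cts 2 0) φ) /
          (∫ φ : Cfg P j N, weight C η w c m2 (0 : VecField P j ℝ) φ)) *
        ((∫ φ : Cfg P j N, weight C η w c m2 (0 : VecField P j ℝ) φ * P4 C η w c μ2 (cts 2 0) (cts 4 0) φ) /
          (∫ φ : Cfg P j N, weight C η w c m2 (0 : VecField P j ℝ) φ))
      + 30 * ((∫ φ : Cfg P j N, weight C η w c m2 (0 : VecField P j ℝ) φ * P2 C η w c μ2 (cts 2 0) φ) /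
          (∫ φ : Cfg P j N, weight C η w c m2 (0 : VecField P j ℝ) φ)) ^ 3 := by
  obtain ⟨-, -, e6⟩ := iteratedDeriv_logZ_massCurve_raw C η w c m2 μ2 hw hm hμ hct hS h0S hBc hmass heven
  have h1 : cts 1 0 = 0 := cts_odd_zero hct heven 0
  have h3 : cts 3 0 = 0 := cts_odd_zero hct heven 1
  have h5 : cts 5 0 = 0 := cts_odd_zero hct heven 2
  have hi2 := integrable_DkM_J_mul C η w c m2 μ2 hw hm hμ hBc hmass (ExpGrowth.const (P := P) (j := j) (N := N) (1 : ℝ)) 2 h0S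
  have hi4 := integrable_DkM_J_mul C η w c m2 μ2 hw hm hμ hBc hmass (ExpGrowth.const (P := P) (j := j) (N := N) (1 : ℝ)) 4 h0S
  have hi6 := integrable_DkM_J_mul C η w c m2 μ2 hw hm hμ hBc hmass (ExpGrowth.const (P := P) (j := j) (N := N) (1 : ℝ)) 6 h0S
  rw [h00, add_zero] at hi2 hi4 hi6
  have n2 := integral_DkM_J_zero_eq C η w c m2 μ2 2 (F := fun _ => (1 : ℝ)) hi2 (wai_DkM_two C η w c μ2 hw hμ h1)
  have n4 := integral_DkM_J_zero_eq C η w c m2 μ2 4 (F := fun _ => (1 : ℝ)) hi4 (wai_DkM_four C η w c μ2 hw hμ h1 h3)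
  have n6 := integral_DkM_J_zero_eq C η w c m2 μ2 6 (F := fun _ => (1 : ℝ)) hi6 (wai_DkM_six C η w c μ2 hw hμ h1 h3 h5)
  simp only [mul_one] at n2 n4 n6
  rw [h00, add_zero] at e6
  rw [n2, n4, n6, B3Eq124VacuumChargeWick.integral_J_zero_eq C η w c m2 μ2 0 rfl] at e6
  have hZA : (∫ A : Cfg P j P.d, WA η w c μ2 A) ≠ 0 := (ZA_pos η w c μ2 hw hμ).ne'
  have hZ0 : (∫ φ : Cfg P j N, weight C η w c m2 (0 : VecField P j ℝ) φ) ≠ 0 := (B3WT226Traces.Z_pos C η w c m2 hw hm).ne'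
  rw [e6]
  field_simp

/-- **THE INDEX `(6,0)` FOR PRINT'S CURVE `δm² = δm²_{(2,0)}e² + δm²_{(4,0)}e⁴`** (`ct″(0) = 2δ₂`, `ct⁗(0) = 24δ₄`, `ct⁽⁶⁾(0) = 0`):
hypotheses `η^d, m², μ₀² > 0` only. [cite: Balaban1983Higgs3, (1.23)–(1.24) p.417, p.418] -/
theorem iteratedDeriv_six_logZ_poly (hw : 0 < w) (hm : 0 < m2) (hμ : 0 < μ2) (δ₂ δ₄ : ℝ) :
    iteratedDeriv 6 (fun e => Real.log (∫ p : JCfg P j N, J C η w c (m2 + (δ₂ * e ^ 2 + δ₄ * e ^ 4)) μ2 e p)) 0 =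
      (∫ φ : Cfg P j N, weight C η w c m2 (0 : VecField P j ℝ) φ * P6 C η w c μ2 (2 * δ₂) (24 * δ₄) 0 φ) /
        (∫ φ : Cfg P j N, weight C η w c m2 (0 : VecField P j ℝ) φ)
      - 15 * ((∫ φ : Cfg P j N, weight C η w c m2 (0 : VecField P j ℝ) φ * P2 C η w c μ2 (2 * δ₂) φ) /
          (∫ φ : Cfg P j N, weight C η w c m2 (0 : VecField P j ℝ) φ)) *
        ((∫ φ : Cfg P j N, weight C η w c m2 (0 : VecField P j ℝ) φ * P4 C η w c μ2 (2 * δ₂) (24 * δ₄) φ) /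
          (∫ φ : Cfg P j N, weight C η w c m2 (0 : VecField P j ℝ) φ))
      + 30 * ((∫ φ : Cfg P j N, weight C η w c m2 (0 : VecField P j ℝ) φ * P2 C η w c μ2 (2 * δ₂) φ) /
          (∫ φ : Cfg P j N, weight C η w c m2 (0 : VecField P j ℝ) φ)) ^ 3 := by
  obtain ⟨r, hr, hr1, hmass⟩ := exists_ball_polyCts m2 hm δ₂ δ₄
  have hBc : ∀ (i : ℕ), ∀ e ∈ Metric.ball (0 : ℝ) r, |polyCts δ₂ δ₄ i e| ≤ 24 * (|δ₂| + |δ₄|) := fun i e he =>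
    abs_polyCts_le δ₂ δ₄ i (by
      have h := Metric.mem_ball.mp he
      rw [Real.dist_eq, sub_zero] at h
      linarith)
  have h := iteratedDeriv_six_logZ_massCurve (P := P) (j := j) C η w c m2 μ2 hw hm hμ (hasDerivAt_polyCts δ₂ δ₄)
    Metric.isOpen_ball (Metric.mem_ball_self hr) hBc hmass
    (fun e => by show δ₂ * (-e) ^ 2 + δ₄ * (-e) ^ 4 = δ₂ * e ^ 2 + δ₄ * e ^ 4; ring)
    (by show δ₂ * (0 : ℝ) ^ 2 + δ₄ * (0 : ℝ) ^ 4 = 0; norm_num)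
  have e2 : polyCts δ₂ δ₄ 2 0 = 2 * δ₂ := by show 2 * δ₂ + 12 * δ₄ * (0 : ℝ) ^ 2 = 2 * δ₂; norm_num
  have e4 : polyCts δ₂ δ₄ 4 0 = 24 * δ₄ := rfl
  have e6 : polyCts δ₂ δ₄ 6 0 = 0 := rfl
  rw [e2, e4, e6] at h
  exact h

end IndexSixZero


end Literature.MathematicalPhysics.QuantumFieldTheory.Balaban1983to89.B3Eq124IndexSixZero

end
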